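/-
Copyright (c) 2026 the pub-hodgecm-mathlib formalisation cell (harness21).  Prover seat hodgecm-mathlib-F0P3a-p01 (g37), FLOOR 0, SUPPORTS-ONLY on h413; β-BOARD v1
(assembler): the TOWER-2 twins of LH7-p05 (g0)'s ★ p861363 R7 «GLUE CLASSES» empty cuts (rows R7-A₂, A′₂-glue, R7-B₂), by the (0 1)-swap transport.  2026-09-04.
-/
import Summits.HodgeConjecture.HodgeConjecture.Theorems.F0P3cDyRamLabelledOddGlueClasses       -- ★ p861363 (LH7-p05 (g0)): the four tower-1 empty cuts `not_shell_of_mem_stratum_G1_{offFoot, offFoot_glue, foot_tube, foot_top}`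
import Summits.HodgeConjecture.HodgeConjecture.Theorems.F0P3cDyRamLabelledOddPureStrataG2      -- ★ p860856 (LH4-p11 (g8)): brings the §P transport kit (`image_mapGL_stratum`, `isElementDatum_swap`, `coe_conj_eq_diagonal`, `latticeInLevel_diagonal_mapGL_perm_iff`)
import HarnessLib

/-!
# Crux `H413`, line LH4 «(D-RAM) FOUR-FRAME» — (β) Stage B, β-BOARD row R7 FOR TOWER 2: the glue classes of the glued stratum `G₂ = (2ρ+s, 2ρ, 2ρ+s)` off the tube read —
# the clean-shell CUT is EMPTY off the foot off both reads, off the foot in the glue region, and on the foot in the tube range ∕ above the top; so the labelled-odd table is `0` there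

Cell `hodgecm-mathlib` (D-0151), FLOOR 0, crux item H413 = `stmt-HodgeConjecture-24833`, route `HCCMUnconditional`; squad F0∕P3c∕LH4.  THEOREMS ONLY (no `def`, no instance, no
notation, no `sorry`, default heartbeats); ★-only imports; lane `--supports stmt-HodgeConjecture-24833 --as helper` (count-neutral); pays NO row, states NO law.

THE MATHEMATICS.  The (0 1)-swap transport (★ §P kit, as in ★ p860856 §1 and ★ p861597): a member of the tower-2 stratum `(2ρ+s, 2ρ, 2ρ+s)` of `𝓛₀(diag(α, β, 1))` is `mapGL P M′`
for a member `M′` of the tower-1 stratum `(2ρ, 2ρ+s, 2ρ+s)` of `𝓛₀(diag(β, α, 1))` (★ `image_mapGL_stratum`, ★ `coe_conj_eq_diagonal`); `(β, α; n₂, n₁, n₃)` is an element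
datum (★ `isElementDatum_swap`); and the three clean-shell tokens of `diag(α−1, β−1, 0)` ∕ `diag((α−1)², (β−1)², 0)` on `mapGL P M′` are those of the swapped diagonals on `M′`
(★ `latticeInLevel_diagonal_mapGL_perm_iff`).  So each of LH7-p05 (g0)'s four ★ p861363 «no member of the cut» theorems for tower 1 at the swapped datum gives the tower-2
statement with the letters swapped: foot `n₂ = n₁ + s`, read `2ρ+s+ℓ₀ = n₂`, κ-locus `2ρ+ℓ₀ = n₁`, glue region `min n₁ n₃ < 2ρ + ℓ₀`, tube range `2ρ+ℓ₀+2 ≤ n₁`, top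
`2n₁ < 2ρ + mcOfRecord d` (§1); hence the four `= 0` rows of the tower-2 dispatcher ★ p861654 `restValue_G2_of_rows` — its `hA` letter verbatim, and its `hB` letter as the union
of the tube-range and top rows (§2–§3).  The window row R7-C₂ (`n₁ ≤ 2ρ+ℓ₀`, `2ρ + mc ≤ 2n₁`) is NOT here (tower-1 original pending, LH7-p05∕LH7-p07 (g0)).
HONEST LABEL.  Count-neutral helper (EMPTY cuts, value `0`); R6∕R7-C∕R8, `hRest`, (β), T₊ remain OPEN; `HC_CM` is proved only modulo the 7 printed citations (2 remaining named
inputs: hLiu418 = `stmt-HodgeConjecture-24832`, h413 = `stmt-HodgeConjecture-24833`) until rung 0 closes.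

## References
* [Kottwitz1986BaseChangeUnits] R. E. Kottwitz, *Base change for unit elements of Hecke algebras*, Compositio Math. 60 (1986), §1 pp. 240–241 (lattice counts by strata; stability).
* [Serre1980Trees] J.-P. Serre, *Trees*, Springer (1980), Ch. II §1.1 (lattices `g·𝒪^N`, Hermite normal forms).
* [Rogawski1990] J. D. Rogawski, *Automorphic Representations of Unitary Groups in Three Variables*, Ann. of Math. Stud. 123 (1990), §4.9 Prop. 4.9.1 (a)(b) p. 55.
-/

set_option autoImplicit false

noncomputable section

namespace Summit.HodgeConjecture.HodgeConjecture.Cruxes.H413.F0P3cDyRamLabelledOddGlueClassesG2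

open Literature.NumberTheory.Automorphic Literature.NumberTheory.Automorphic.HermitianLattice
open Literature.NumberTheory.Automorphic.UnitaryLatticeTree Literature.NumberTheory.Automorphic.UnitaryThreeFourFrame
open Summit.HodgeConjecture.HodgeConjecture.Cruxes.H413.F0P3cDyRamFourFramePieces
open Summit.HodgeConjecture.HodgeConjecture.Cruxes.H413.F0P3cDyRamFourFrameCensusDefs
open Summit.HodgeConjecture.HodgeConjecture.Cruxes.H413.F0P3cDyRamStageOneBDefs (mcOfRecord)
open Summit.HodgeConjecture.HodgeConjecture.Cruxes.H413.F0P3cDyRamDiagonalTorusDefs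
open Summit.HodgeConjecture.HodgeConjecture.Cruxes.H413.F0P3cDyRamDiagonalStrataDefs
open Summit.HodgeConjecture.HodgeConjecture.Cruxes.H413.F0P3cDyRamLabelledOddCountDefs
open Summit.HodgeConjecture.HodgeConjecture.Cruxes.H413.F0P3cDyRamDiagonalPermutation
open Summit.HodgeConjecture.HodgeConjecture.Cruxes.H413.F0P3cDyRamLabelledStrataPermutation (latticeInLevel_diagonal_mapGL_perm_iff)
open Summit.HodgeConjecture.HodgeConjecture.Cruxes.H413.F0P3cDyRamLabelledOddGlueClasses
open scoped Valued WithZero Matrix MatrixGroups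

variable {K : Type} [Field K] [Valued K ℤᵐ⁰] {σ : K →+* K} {ϖ : K} {d t : ℕ} {α β : K} {N₀ n₁ n₂ n₃ : ℕ}

/-! ## §1  The transport of an empty clean-shell cut from tower 1 (swapped datum) to tower 2 -/

/-- **TRANSPORT OF AN EMPTY CUT.**  If, for the swapped torus element `diag(β, α, 1)`, no member of the tower-1 stratum `(2ρ, 2ρ+s, 2ρ+s)` carries the three clean-shell
tokens of the swapped diagonals `diag(β−1, α−1, 0)` ∕ `diag((β−1)², (α−1)², 0)` at levels `(ℓ, ℓ+1, ℓ₂)`, then no member of the tower-2 stratum `(2ρ+s, 2ρ, 2ρ+s)` of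
`diag(α, β, 1)` carries those of `diag(α−1, β−1, 0)` ∕ `diag((α−1)², (β−1)², 0)`. [cite: Kottwitz1986BaseChangeUnits, §1 pp. 240–241] [cite: Serre1980Trees, Ch. II §1.1] -/
theorem not_shell_of_mem_stratum_G2_of_swap (T : GL (Fin 3) K) (hT : (T : Matrix (Fin 3) (Fin 3) K) = Matrix.diagonal ![α, β, 1]) (ρ s ℓ ℓ₂ : ℕ)
    (h : ∀ T' : GL (Fin 3) K, (T' : Matrix (Fin 3) (Fin 3) K) = Matrix.diagonal ![β, α, 1] →
      ∀ M' ∈ stratum σ ϖ T' ![2 * ρ, 2 * ρ + s, 2 * ρ + s],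
        ¬ (LatticeInLevel ϖ ℓ (Matrix.diagonal ![β - 1, α - 1, 0]) M' ∧ ¬ LatticeInLevel ϖ (ℓ + 1) (Matrix.diagonal ![β - 1, α - 1, 0]) M' ∧
            LatticeInLevel ϖ ℓ₂ (Matrix.diagonal ![(β - 1) * (β - 1), (α - 1) * (α - 1), 0]) M')) :
    ∀ M ∈ stratum σ ϖ T ![2 * ρ + s, 2 * ρ, 2 * ρ + s],
      ¬ (LatticeInLevel ϖ ℓ (Matrix.diagonal ![α - 1, β - 1, 0]) M ∧ ¬ LatticeInLevel ϖ (ℓ + 1) (Matrix.diagonal ![α - 1, β - 1, 0]) M ∧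
          LatticeInLevel ϖ ℓ₂ (Matrix.diagonal ![(α - 1) * (α - 1), (β - 1) * (β - 1), 0]) M) := by
  intro M hM
  obtain ⟨P, hP⟩ := exists_gl_coe_eq_permMatrix (K := K) (Equiv.swap (0 : Fin 3) 1)
  have ha : (![2 * ρ + s, 2 * ρ, 2 * ρ + s] : Fin 3 → ℕ) ∘ ⇑(Equiv.swap (0 : Fin 3) 1).symm = ![2 * ρ, 2 * ρ + s, 2 * ρ + s] := by
    ext i; fin_cases i <;> rfl
  have hd : (![α, β, 1] : Fin 3 → K) ∘ ⇑(Equiv.swap (0 : Fin 3) 1).symm = ![β, α, 1] := by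
    ext i; fin_cases i <;> rfl
  have he₁ : (![α - 1, β - 1, 0] : Fin 3 → K) ∘ ⇑(Equiv.swap (0 : Fin 3) 1).symm = ![β - 1, α - 1, 0] := by
    ext i; fin_cases i <;> rfl
  have he₂ : (![(α - 1) * (α - 1), (β - 1) * (β - 1), 0] : Fin 3 → K) ∘ ⇑(Equiv.swap (0 : Fin 3) 1).symm = ![(β - 1) * (β - 1), (α - 1) * (α - 1), 0] := by
    ext i; fin_cases i <;> rfl
  have hT'' : ((P⁻¹ * T * P : GL (Fin 3) K) : Matrix (Fin 3) (Fin 3) K) = Matrix.diagonal ![β, α, 1] := by rw [coe_conj_eq_diagonal P hP T hT, hd]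
  have himg := image_mapGL_stratum σ ϖ P hP T (![2 * ρ + s, 2 * ρ, 2 * ρ + s] : Fin 3 → ℕ)
  rw [ha] at himg
  rw [← himg] at hM
  obtain ⟨M', hM', rfl⟩ := hM
  rw [latticeInLevel_diagonal_mapGL_perm_iff P hP, latticeInLevel_diagonal_mapGL_perm_iff P hP, latticeInLevel_diagonal_mapGL_perm_iff P hP, he₁, he₂]
  exact h (P⁻¹ * T * P) hT'' M' hM'

/-- **ANY EMPTY CLEAN-SHELL CUT OF `G₂` HAS LABELLED-ODD TABLE `0`** (the common β-BOARD shape; the bookkeeping step shared by §2–§3). [cite: Kottwitz1986BaseChangeUnits, §1 pp. 240–241] -/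
theorem finsum_stratum_G2_shell_labelledOdd_div_relIndex_eq_zero_of_not_shell (T : GL (Fin 3) K) (ρ s : ℕ)
    (h : ∀ M ∈ stratum σ ϖ T ![2 * ρ + s, 2 * ρ, 2 * ρ + s],
      ¬ (LatticeInLevel ϖ (d % 2) (Matrix.diagonal ![α - 1, β - 1, 0]) M ∧ ¬ LatticeInLevel ϖ (d % 2 + 1) (Matrix.diagonal ![α - 1, β - 1, 0]) M ∧
          LatticeInLevel ϖ (mcOfRecord d) (Matrix.diagonal ![(α - 1) * (α - 1), (β - 1) * (β - 1), 0]) M)) (i : Fin 3) :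
    ∑ᶠ M ∈ {M : Submodule 𝒪[K] (Fin 3 → K) | M ∈ stratum σ ϖ T ![2 * ρ + s, 2 * ρ, 2 * ρ + s] ∧
        (LatticeInLevel ϖ (d % 2) (Matrix.diagonal ![α - 1, β - 1, 0]) M ∧ ¬ LatticeInLevel ϖ (d % 2 + 1) (Matrix.diagonal ![α - 1, β - 1, 0]) M ∧
          LatticeInLevel ϖ (mcOfRecord d) (Matrix.diagonal ![(α - 1) * (α - 1), (β - 1) * (β - 1), 0]) M)},
      (labelledOddCount σ ϖ 0 i (valueClassLabel σ ϖ (α - 1) (β - 1) (mstarOfRecord d) d) M : ℚ) /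
        ((((unitStabilizer M).map (unitNormMap σ 3)).relIndex (fixedUnitTorus σ 3) : ℕ) : ℚ) = 0 := by
  have hempty : {M : Submodule 𝒪[K] (Fin 3 → K) | M ∈ stratum σ ϖ T ![2 * ρ + s, 2 * ρ, 2 * ρ + s] ∧
        (LatticeInLevel ϖ (d % 2) (Matrix.diagonal ![α - 1, β - 1, 0]) M ∧ ¬ LatticeInLevel ϖ (d % 2 + 1) (Matrix.diagonal ![α - 1, β - 1, 0]) M ∧
          LatticeInLevel ϖ (mcOfRecord d) (Matrix.diagonal ![(α - 1) * (α - 1), (β - 1) * (β - 1), 0]) M)} = ∅ :=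
    Set.eq_empty_of_forall_notMem fun M hM => h M hM.1 hM.2
  rw [hempty, finsum_mem_empty]

/-! ## §2  Off the foot `n₂ ≠ n₁ + s`: R7-A₂ (off both reads) and the glue region -/

/-- **R7-A₂ · OFF THE FOOT, OFF BOTH READS: `G₂` CARRIES LABELLED-ODD VALUE `0`** (`n₂ ≠ n₁ + s`, `2ρ+s+ℓ₀ ≠ n₂`, `2ρ+ℓ₀ ≠ n₁`) — the `hA` letter of ★ p861654
`restValue_G2_of_rows` verbatim (★ p861363 `not_shell_of_mem_stratum_G1_offFoot` at the swapped datum). [cite: Kottwitz1986BaseChangeUnits, §1 pp. 240–241]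
[cite: Rogawski1990, §4.9 Prop. 4.9.1 (a)(b) p. 55] -/
theorem finsum_stratum_G2_shell_labelledOdd_div_relIndex_eq_zero_of_offFoot (hD : IsRamifiedQuadraticDatum σ ϖ d t) (h2d : 2 ≤ d)
    (hE : IsElementDatum σ ϖ N₀ α β n₁ n₂ n₃) (hmc : mcOfRecord d ≤ N₀)
    (T : GL (Fin 3) K) (hT : (T : Matrix (Fin 3) (Fin 3) K) = Matrix.diagonal ![α, β, 1]) (ρ s : ℕ) (hρ : 1 ≤ ρ) (hs : 1 ≤ s)
    (hfoot : n₂ ≠ n₁ + s) (hread : 2 * ρ + s + d % 2 ≠ n₂) (hκ : 2 * ρ + d % 2 ≠ n₁) (i : Fin 3) :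
    ∑ᶠ M ∈ {M : Submodule 𝒪[K] (Fin 3 → K) | M ∈ stratum σ ϖ T ![2 * ρ + s, 2 * ρ, 2 * ρ + s] ∧
        (LatticeInLevel ϖ (d % 2) (Matrix.diagonal ![α - 1, β - 1, 0]) M ∧ ¬ LatticeInLevel ϖ (d % 2 + 1) (Matrix.diagonal ![α - 1, β - 1, 0]) M ∧
          LatticeInLevel ϖ (mcOfRecord d) (Matrix.diagonal ![(α - 1) * (α - 1), (β - 1) * (β - 1), 0]) M)},
      (labelledOddCount σ ϖ 0 i (valueClassLabel σ ϖ (α - 1) (β - 1) (mstarOfRecord d) d) M : ℚ) /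
        ((((unitStabilizer M).map (unitNormMap σ 3)).relIndex (fixedUnitTorus σ 3) : ℕ) : ℚ) = 0 :=
  finsum_stratum_G2_shell_labelledOdd_div_relIndex_eq_zero_of_not_shell T ρ s
    (not_shell_of_mem_stratum_G2_of_swap T hT ρ s (d % 2) (mcOfRecord d) fun T' hT' =>
      not_shell_of_mem_stratum_G1_offFoot hD h2d (isElementDatum_swap hE) hmc T' hT' ρ s hρ hs hfoot hread hκ) i

/-- **OFF THE FOOT IN THE GLUE REGION `min n₁ n₃ < 2ρ + ℓ₀`: `G₂` CARRIES LABELLED-ODD VALUE `0`** (★ p861363 `not_shell_of_mem_stratum_G1_offFoot_glue` at the swapped datum; a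
variant of ★ p861597's cell A′₂ with the level letter `ℓ₀` included). [cite: Kottwitz1986BaseChangeUnits, §1 pp. 240–241] [cite: Rogawski1990, §4.9 Prop. 4.9.1 (a)(b) p. 55] -/
theorem finsum_stratum_G2_shell_labelledOdd_div_relIndex_eq_zero_of_offFoot_glue (hD : IsRamifiedQuadraticDatum σ ϖ d t)
    (hE : IsElementDatum σ ϖ N₀ α β n₁ n₂ n₃)
    (T : GL (Fin 3) K) (hT : (T : Matrix (Fin 3) (Fin 3) K) = Matrix.diagonal ![α, β, 1]) (ρ s : ℕ) (hρ : 1 ≤ ρ) (hs : 1 ≤ s)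
    (hfoot : n₂ ≠ n₁ + s) (hglue : min n₁ n₃ < 2 * ρ + d % 2) (i : Fin 3) :
    ∑ᶠ M ∈ {M : Submodule 𝒪[K] (Fin 3 → K) | M ∈ stratum σ ϖ T ![2 * ρ + s, 2 * ρ, 2 * ρ + s] ∧
        (LatticeInLevel ϖ (d % 2) (Matrix.diagonal ![α - 1, β - 1, 0]) M ∧ ¬ LatticeInLevel ϖ (d % 2 + 1) (Matrix.diagonal ![α - 1, β - 1, 0]) M ∧
          LatticeInLevel ϖ (mcOfRecord d) (Matrix.diagonal ![(α - 1) * (α - 1), (β - 1) * (β - 1), 0]) M)},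
      (labelledOddCount σ ϖ 0 i (valueClassLabel σ ϖ (α - 1) (β - 1) (mstarOfRecord d) d) M : ℚ) /
        ((((unitStabilizer M).map (unitNormMap σ 3)).relIndex (fixedUnitTorus σ 3) : ℕ) : ℚ) = 0 :=
  finsum_stratum_G2_shell_labelledOdd_div_relIndex_eq_zero_of_not_shell T ρ s
    (not_shell_of_mem_stratum_G2_of_swap T hT ρ s (d % 2) (mcOfRecord d) fun T' hT' =>
      not_shell_of_mem_stratum_G1_offFoot_glue hD (isElementDatum_swap hE) T' hT' ρ s hρ hs hfoot hglue) i

/-! ## §3  On the foot `n₂ = n₁ + s`: R7-B₂ (tube range ∪ top) -/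

/-- **ON THE FOOT IN THE TUBE RANGE `2ρ + ℓ₀ + 2 ≤ n₁`: `G₂` CARRIES LABELLED-ODD VALUE `0`** (★ p861363 `not_shell_of_mem_stratum_G1_foot_tube` at the swapped datum).
[cite: Kottwitz1986BaseChangeUnits, §1 pp. 240–241] [cite: Rogawski1990, §4.9 Prop. 4.9.1 (a)(b) p. 55] -/
theorem finsum_stratum_G2_shell_labelledOdd_div_relIndex_eq_zero_of_foot_tube (hD : IsRamifiedQuadraticDatum σ ϖ d t)
    (hE : IsElementDatum σ ϖ N₀ α β n₁ n₂ n₃)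
    (T : GL (Fin 3) K) (hT : (T : Matrix (Fin 3) (Fin 3) K) = Matrix.diagonal ![α, β, 1]) (ρ s : ℕ) (hρ : 1 ≤ ρ) (hs : 1 ≤ s)
    (hfoot : n₂ = n₁ + s) (htube : 2 * ρ + d % 2 + 2 ≤ n₁) (i : Fin 3) :
    ∑ᶠ M ∈ {M : Submodule 𝒪[K] (Fin 3 → K) | M ∈ stratum σ ϖ T ![2 * ρ + s, 2 * ρ, 2 * ρ + s] ∧
        (LatticeInLevel ϖ (d % 2) (Matrix.diagonal ![α - 1, β - 1, 0]) M ∧ ¬ LatticeInLevel ϖ (d % 2 + 1) (Matrix.diagonal ![α - 1, β - 1, 0]) M ∧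
          LatticeInLevel ϖ (mcOfRecord d) (Matrix.diagonal ![(α - 1) * (α - 1), (β - 1) * (β - 1), 0]) M)},
      (labelledOddCount σ ϖ 0 i (valueClassLabel σ ϖ (α - 1) (β - 1) (mstarOfRecord d) d) M : ℚ) /
        ((((unitStabilizer M).map (unitNormMap σ 3)).relIndex (fixedUnitTorus σ 3) : ℕ) : ℚ) = 0 :=
  finsum_stratum_G2_shell_labelledOdd_div_relIndex_eq_zero_of_not_shell T ρ s
    (not_shell_of_mem_stratum_G2_of_swap T hT ρ s (d % 2) (mcOfRecord d) fun T' _ =>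
      not_shell_of_mem_stratum_G1_foot_tube hD (isElementDatum_swap hE) T' ρ s hρ hs hfoot htube) i

/-- **ON THE FOOT ABOVE THE TOP `2n₁ < 2ρ + mcOfRecord d`: `G₂` CARRIES LABELLED-ODD VALUE `0`** (★ p861363 `not_shell_of_mem_stratum_G1_foot_top` at the swapped datum).
[cite: Kottwitz1986BaseChangeUnits, §1 pp. 240–241] [cite: Rogawski1990, §4.9 Prop. 4.9.1 (a)(b) p. 55] -/
theorem finsum_stratum_G2_shell_labelledOdd_div_relIndex_eq_zero_of_foot_top (hD : IsRamifiedQuadraticDatum σ ϖ d t)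
    (hE : IsElementDatum σ ϖ N₀ α β n₁ n₂ n₃)
    (T : GL (Fin 3) K) (hT : (T : Matrix (Fin 3) (Fin 3) K) = Matrix.diagonal ![α, β, 1]) (ρ s : ℕ) (hρ : 1 ≤ ρ) (hs : 1 ≤ s)
    (hfoot : n₂ = n₁ + s) (htop : 2 * n₁ < 2 * ρ + mcOfRecord d) (i : Fin 3) :
    ∑ᶠ M ∈ {M : Submodule 𝒪[K] (Fin 3 → K) | M ∈ stratum σ ϖ T ![2 * ρ + s, 2 * ρ, 2 * ρ + s] ∧
        (LatticeInLevel ϖ (d % 2) (Matrix.diagonal ![α - 1, β - 1, 0]) M ∧ ¬ LatticeInLevel ϖ (d % 2 + 1) (Matrix.diagonal ![α - 1, β - 1, 0]) M ∧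
          LatticeInLevel ϖ (mcOfRecord d) (Matrix.diagonal ![(α - 1) * (α - 1), (β - 1) * (β - 1), 0]) M)},
      (labelledOddCount σ ϖ 0 i (valueClassLabel σ ϖ (α - 1) (β - 1) (mstarOfRecord d) d) M : ℚ) /
        ((((unitStabilizer M).map (unitNormMap σ 3)).relIndex (fixedUnitTorus σ 3) : ℕ) : ℚ) = 0 :=
  finsum_stratum_G2_shell_labelledOdd_div_relIndex_eq_zero_of_not_shell T ρ s
    (not_shell_of_mem_stratum_G2_of_swap T hT ρ s (d % 2) (mcOfRecord d) fun T' _ =>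
      not_shell_of_mem_stratum_G1_foot_top hD (isElementDatum_swap hE) T' ρ s hρ hs hfoot htop) i

/-- **THE `hB` LETTER OF ★ p861654 `restValue_G2_of_rows`** (on the foot, tube range OR above the top ⇒ `0`): the union of §3's two rows.
[cite: Kottwitz1986BaseChangeUnits, §1 pp. 240–241] [cite: Rogawski1990, §4.9 Prop. 4.9.1 (a)(b) p. 55] -/
theorem finsum_stratum_G2_shell_labelledOdd_div_relIndex_eq_zero_of_foot_tube_or_top (hD : IsRamifiedQuadraticDatum σ ϖ d t)
    (hE : IsElementDatum σ ϖ N₀ α β n₁ n₂ n₃)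
    (T : GL (Fin 3) K) (hT : (T : Matrix (Fin 3) (Fin 3) K) = Matrix.diagonal ![α, β, 1]) (ρ s : ℕ) (hρ : 1 ≤ ρ) (hs : 1 ≤ s)
    (hfoot : n₂ = n₁ + s) (hoff : 2 * ρ + d % 2 + 2 ≤ n₁ ∨ 2 * n₁ < 2 * ρ + mcOfRecord d) (i : Fin 3) :
    ∑ᶠ M ∈ {M : Submodule 𝒪[K] (Fin 3 → K) | M ∈ stratum σ ϖ T ![2 * ρ + s, 2 * ρ, 2 * ρ + s] ∧
        (LatticeInLevel ϖ (d % 2) (Matrix.diagonal ![α - 1, β - 1, 0]) M ∧ ¬ LatticeInLevel ϖ (d % 2 + 1) (Matrix.diagonal ![α - 1, β - 1, 0]) M ∧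
          LatticeInLevel ϖ (mcOfRecord d) (Matrix.diagonal ![(α - 1) * (α - 1), (β - 1) * (β - 1), 0]) M)},
      (labelledOddCount σ ϖ 0 i (valueClassLabel σ ϖ (α - 1) (β - 1) (mstarOfRecord d) d) M : ℚ) /
        ((((unitStabilizer M).map (unitNormMap σ 3)).relIndex (fixedUnitTorus σ 3) : ℕ) : ℚ) = 0 := by
  rcases hoff with htube | htop
  · exact finsum_stratum_G2_shell_labelledOdd_div_relIndex_eq_zero_of_foot_tube hD hE T hT ρ s hρ hs hfoot htube i
  · exact finsum_stratum_G2_shell_labelledOdd_div_relIndex_eq_zero_of_foot_top hD hE T hT ρ s hρ hs hfoot htop i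

end Summit.HodgeConjecture.HodgeConjecture.Cruxes.H413.F0P3cDyRamLabelledOddGlueClassesG2

end
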